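import Literature.Probability.RandomPlanarGeometry.SAWCountMonotoneReversal
import HarnessLib

/-!
# Monotonicity `cₙ ≤ cₙ₊₁` (O'Brien 1990): the ESCAPE injection — `cₙ ≤ cₙ₊₁ + #R` with `R` the walks
# whose start is completely surrounded and whose end cannot escape to infinity

A second reduction of the named fact `BDGS2012_count_mono` (`cₙ ≤ cₙ₊₁` on `ℤ^d`, O'Brien 1990), by a
different idea than the reversal pairing of `SAWCountMonotoneReversal.lean` (`cₙ ≤ cₙ₊₁ + #T₂`,
`T₂` = end trapped and at most one free start site).  Call the END of an `n`-step self-avoiding walk `ω`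
FREE if there is an **escape route**: an infinite self-avoiding nearest-neighbour path starting next
to `ω n` and avoiding every site of `ω`; otherwise the end is DOOMED (it lies, together with everything
it can still reach, in a finite pocket — in particular every trapped end is doomed).  The map

* end free  ⟼ prolong `ω` by the FIRST STEP of an escape route (the new end is again free: the rest
  of the route escapes from it);
* end doomed, some neighbour of the start unvisited  ⟼ PREPEND that neighbour (re-rooted; the end is
  unchanged, hence still doomed),

is injective (delete the last, resp. the first, step) and its two parts have disjoint images (free vs
doomed end).  Hence

* `count_le_count_succ_add_card_escapeResidual` : **`cₙ ≤ cₙ₊₁ + #R`**, where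
  `R = escapeResidual d n` = the `n`-step walks with a DOOMED end AND a completely surrounded start;
* `count_le_count_succ_of_escapeResidual_eq_empty` : O'Brien's inequality wherever `R = ∅`;
* `escapeResidual_subset_start_surrounded`, `bothTrapped_subset_escapeResidual` : `R` sits between
  the walks trapped at BOTH ends and the walks with a surrounded start.

On `ℤ²` the residual is far smaller than `T₂`: `#R = 0` for `n ≤ 10` and `8, 16` for `n = 11, 12`
against `#T₂ = 8, 8, 80, 80` for `n = 9, …, 12` (exhaustive enumeration, lane «pcv-sawmu» a-p4 g26,
kit j306921; not used in any proof).  The escape route is a lane construction; the vocabulary is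
Madras–Slade §1.1.

[cite: MadrasSlade1993, §1.1 (self-avoiding walks on `ℤ^d`); §7.1 p. 231 (`c_{N+1} ≥ c_N`, O'Brien)]
[cite: BDGS2012, §1.3 (`cₙ ≤ cₙ₊₁`, O'Brien 1990)]
-/

noncomputable section

open Literature.Probability.LatticeModels Literature.Probability.Percolation SimpleGraph

namespace Literature.Probability.RandomPlanarGeometry.SAW.Zd

variable {d : ℕ}

/-! ### Escape routes -/

/-- `P` is an **escape route** for `ω` at time `n`: an infinite self-avoiding nearest-neighbour path
`P 0, P 1, …` with `P 0` adjacent to `ω n` and no `P i` among the sites `ω 0, …, ω n`.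
[cite: MadrasSlade1993, §1.1] -/
def IsEscape (ω : ℕ → Site d) (n : ℕ) (P : ℕ → Site d) : Prop :=
  (zdGraph d).Adj (ω n) (P 0) ∧ (∀ i, (zdGraph d).Adj (P i) (P (i + 1))) ∧ Function.Injective P ∧
    ∀ i j, j ≤ n → P i ≠ ω j

/-- The end of `ω` (at time `n`) is **free**: it has an escape route. [cite: MadrasSlade1993, §1.1] -/
def EndFree (ω : ℕ → Site d) (n : ℕ) : Prop := ∃ P, IsEscape ω n P

/-- The first site of an escape route is a free extension of the walk. [cite: MadrasSlade1993, §1.1] -/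
theorem IsEscape.apply_zero_mem_freeNbrs {ω : ℕ → Site d} {n : ℕ} {P : ℕ → Site d}
    (hP : IsEscape ω n P) : P 0 ∈ freeNbrs ω n :=
  mem_freeNbrs.2 ⟨hP.1, fun i hi h => hP.2.2.2 0 i hi h.symm⟩

/-- A trapped end (`extCount ω n = 0`) is not free. [cite: MadrasSlade1993, §1.1] -/
theorem not_endFree_of_extCount_eq_zero {ω : ℕ → Site d} {n : ℕ} (h : extCount ω n = 0) :
    ¬ EndFree ω n := by
  rintro ⟨P, hP⟩
  have := hP.apply_zero_mem_freeNbrs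
  rw [extCount, Finset.card_eq_zero] at h
  rw [h] at this
  simp at this

/-- **Prolonging along an escape route keeps the end free**: if `P` escapes from `ω` at time `n`, then
`i ↦ P (i+1)` escapes from `extendTo ω n (P 0)` at time `n + 1`. [cite: MadrasSlade1993, §1.1] -/
theorem endFree_extendTo {ω : ℕ → Site d} {n : ℕ} {P : ℕ → Site d} (hP : IsEscape ω n P) :
    EndFree (extendTo ω n (P 0)) (n + 1) := by
  obtain ⟨h0, hadj, hinj, havoid⟩ := hP
  refine ⟨fun i => P (i + 1), ?_, fun i => hadj (i + 1), fun i j h => by simpa using hinj h, ?_⟩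
  · rw [extendTo_of_lt (Nat.lt_succ_self n)]; exact hadj 0
  · intro i j hj
    rcases Nat.lt_or_ge j (n + 1) with hj' | hj'
    · rw [extendTo_of_le (by omega)]; exact havoid (i + 1) j (by omega)
    · rw [extendTo_of_lt (by omega)]
      intro h; exact absurd (hinj h) (by omega)

/-- Freeness of the end is invariant under translating the walk. [cite: MadrasSlade1993, §1.1] -/
theorem endFree_of_translate {ω ω' : ℕ → Site d} {n n' : ℕ} (v : Site d) (hend : ω' n' = ω n + v)
    (hsub : ∀ j ≤ n', ∃ i ≤ n, ω' j = ω i + v) (h : EndFree ω n) : EndFree ω' n' := by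
  obtain ⟨P, h0, hadj, hinj, havoid⟩ := h
  refine ⟨fun i => P i + v, ?_, fun i => (zdGraph_adj_add_right _ _ v).2 (hadj i),
    fun i j hij => hinj (add_right_cancel hij), ?_⟩
  · rw [hend]; exact (zdGraph_adj_add_right _ _ v).2 h0
  · intro i j hj hEq
    obtain ⟨i', hi', hj'⟩ := hsub j hj
    rw [hj'] at hEq
    exact havoid i i' hi' (add_right_cancel hEq)

/-! ### Prepending a free start site (through the reversal) -/

/-- **Prepending** the free start site `ω n - y` (where `y` prolongs the reversed walk): reverse,
prolong by `y`, reverse back.  As a walk from the origin it is `0, ω 0 - z, ω 1 - z, …, ω n - z` with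
`z = ω n - y`. [cite: MadrasSlade1993, §1.1] -/
def prependVia (n : ℕ) (ω : ℕ → Site d) (y : Site d) : ℕ → Site d :=
  revWalk (n + 1) (extendTo (revWalk n ω) n y)

/-- Values of the prepended walk: `prependVia n ω y (i + 1) = ω i - (ω n - y)` for `i ≤ n`.
[cite: MadrasSlade1993, §1.1] -/
theorem prependVia_succ {n : ℕ} {ω : ℕ → Site d} (hω : ω ∈ saws d n) (y : Site d) {i : ℕ} (hi : i ≤ n) :
    prependVia n ω y (i + 1) = ω i - (ω n - y) := by
  obtain ⟨h0, -, -, -⟩ := mem_saws.1 hω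
  simp only [prependVia, revWalk]
  rw [extendTo_of_lt (by omega), show n + 1 - (i + 1) = n - i by omega, extendTo_of_le (Nat.sub_le n i)]
  simp only [revWalk, Nat.sub_sub_self hi]
  abel

/-- The prepended walk is an `(n+1)`-step self-avoiding walk when `y` prolongs the reversed walk.
[cite: MadrasSlade1993, §1.1] -/
theorem prependVia_mem_saws {n : ℕ} {ω : ℕ → Site d} (hω : ω ∈ saws d n) {y : Site d}
    (hy : y ∈ freeNbrs (revWalk n ω) n) : prependVia n ω y ∈ saws d (n + 1) :=
  revWalk_mem_saws (extendTo_mem_saws (revWalk_mem_saws hω) hy)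

/-- Prepending does not free a doomed end. [cite: MadrasSlade1993, §1.1] -/
theorem not_endFree_prependVia {n : ℕ} {ω : ℕ → Site d} (hω : ω ∈ saws d n) (y : Site d)
    (h : ¬ EndFree ω n) : ¬ EndFree (prependVia n ω y) (n + 1) := by
  intro h'
  apply h
  refine endFree_of_translate (ω := prependVia n ω y) (ω' := ω) (n := n + 1) (n' := n) (ω n - y) ?_ ?_ h'
  · rw [prependVia_succ hω y le_rfl]; abel
  · intro j hj
    exact ⟨j + 1, by omega, by rw [prependVia_succ hω y hj]; abel⟩

/-- Prepending is injective on `n`-step self-avoiding walks (delete the first step). [cite: MadrasSlade1993, §1.1] -/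
theorem prependVia_injOn {n : ℕ} {ω₁ ω₂ : ℕ → Site d} (h₁ : ω₁ ∈ saws d n) (h₂ : ω₂ ∈ saws d n)
    {y₁ y₂ : Site d} (hy₁ : y₁ ∈ freeNbrs (revWalk n ω₁) n) (hy₂ : y₂ ∈ freeNbrs (revWalk n ω₂) n)
    (h : prependVia n ω₁ y₁ = prependVia n ω₂ y₂) : ω₁ = ω₂ := by
  have hq₁ := extendTo_mem_saws (revWalk_mem_saws h₁) hy₁
  have hq₂ := extendTo_mem_saws (revWalk_mem_saws h₂) hy₂
  have hq : extendTo (revWalk n ω₁) n y₁ = extendTo (revWalk n ω₂) n y₂ :=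
    revWalk_injOn (n + 1) (Finset.mem_coe.2 hq₁) (Finset.mem_coe.2 hq₂) h
  have hr : revWalk n ω₁ = revWalk n ω₂ := by
    rw [← restrictTo_extendTo (revWalk_mem_saws h₁) y₁, ← restrictTo_extendTo (revWalk_mem_saws h₂) y₂, hq]
  exact revWalk_injOn n (Finset.mem_coe.2 h₁) (Finset.mem_coe.2 h₂) hr

/-! ### The residual set and the escape injection -/

open Classical in
/-- The **escape residual** `R`: `n`-step self-avoiding walks whose end is doomed (no escape route)
and whose start is completely surrounded (`extCount (revWalk n ω) n = 0`). [cite: BDGS2012, §1.3] -/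
def escapeResidual (d n : ℕ) : Finset (ℕ → Site d) :=
  (saws d n).filter fun ω => ¬ EndFree ω n ∧ extCount (revWalk n ω) n = 0

/-- Membership in `escapeResidual`. [cite: BDGS2012, §1.3] -/
theorem mem_escapeResidual {n : ℕ} {ω : ℕ → Site d} :
    ω ∈ escapeResidual d n ↔ ω ∈ saws d n ∧ ¬ EndFree ω n ∧ extCount (revWalk n ω) n = 0 := by
  classical
  rw [escapeResidual, Finset.mem_filter]

open Classical in
/-- `R ⊆` walks with a completely surrounded start. [cite: BDGS2012, §1.3] -/
theorem escapeResidual_subset_start_surrounded (d n : ℕ) :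
    escapeResidual d n ⊆ (saws d n).filter fun ω => extCount (revWalk n ω) n = 0 := by
  intro ω hω
  obtain ⟨h1, -, h3⟩ := mem_escapeResidual.1 hω
  exact Finset.mem_filter.2 ⟨h1, h3⟩

open Classical in
/-- Walks trapped at BOTH ends lie in `R` (a trapped end is doomed); in particular `R ⊆ T₂` fails
only through doomed-but-untrapped ends, while `T₂ \ R` consists of the trapped walks with exactly one
free start site. [cite: BDGS2012, §1.3] -/
theorem bothTrapped_subset_escapeResidual (d n : ℕ) :
    ((saws d n).filter fun ω => extCount ω n = 0 ∧ extCount (revWalk n ω) n = 0) ⊆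
      escapeResidual d n := by
  intro ω hω
  obtain ⟨h1, h2, h3⟩ := Finset.mem_filter.1 hω
  exact mem_escapeResidual.2 ⟨h1, not_endFree_of_extCount_eq_zero h2, h3⟩

open Classical in
/-- **The escape injection** on `n`-step walks outside `R`: prolong along an escape route if the end
is free, else prepend a free start site. (Junk value `ω` on `R`.) [cite: BDGS2012, §1.3] -/
def escapeMap (n : ℕ) (ω : ℕ → Site d) : ℕ → Site d :=
  if h : EndFree ω n then extendTo ω n (Classical.choose h 0)
  else if h' : (freeNbrs (revWalk n ω) n).Nonempty then prependVia n ω (Classical.choose h')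
  else ω

open Classical in
/-- The escape injection maps walks outside `R` to `(n+1)`-step self-avoiding walks.
[cite: BDGS2012, §1.3] -/
theorem escapeMap_mem_saws {n : ℕ} {ω : ℕ → Site d} (hω : ω ∈ saws d n) (hR : ω ∉ escapeResidual d n) :
    escapeMap n ω ∈ saws d (n + 1) := by
  unfold escapeMap
  split_ifs with h h'
  · exact extendTo_mem_saws hω (Classical.choose_spec h).apply_zero_mem_freeNbrs
  · exact prependVia_mem_saws hω (Classical.choose_spec h')
  · exfalso
    refine hR (mem_escapeResidual.2 ⟨hω, h, ?_⟩)
    rw [extCount, Finset.card_eq_zero]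
    exact Finset.not_nonempty_iff_eq_empty.1 h'

open Classical in
/-- Image of a free-ended walk: free end. [cite: BDGS2012, §1.3] -/
theorem endFree_escapeMap {n : ℕ} {ω : ℕ → Site d} (h : EndFree ω n) : EndFree (escapeMap n ω) (n + 1) := by
  unfold escapeMap
  rw [dif_pos h]
  exact endFree_extendTo (Classical.choose_spec h)

open Classical in
/-- Image of a doomed-ended walk outside `R`: doomed end. [cite: BDGS2012, §1.3] -/
theorem not_endFree_escapeMap {n : ℕ} {ω : ℕ → Site d} (hω : ω ∈ saws d n) (h : ¬ EndFree ω n) :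
    ¬ EndFree (escapeMap n ω) (n + 1) := by
  unfold escapeMap
  rw [dif_neg h]
  split_ifs with h'
  · exact not_endFree_prependVia hω _ h
  · -- junk branch: `ω` frozen, its end at time `n + 1` is the doomed end at time `n`
    intro hf
    apply h
    obtain ⟨-, hend, -, -⟩ := mem_saws.1 hω
    refine endFree_of_translate (ω := ω) (ω' := ω) (n := n + 1) (n' := n) 0
      (by rw [add_zero, hend (n + 1) (by omega)]) (fun j hj => ⟨j, by omega, by rw [add_zero]⟩) hf

open Classical in
/-- **The escape injection is injective** outside `R`. [cite: BDGS2012, §1.3] -/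
theorem escapeMap_injOn (d n : ℕ) :
    Set.InjOn (escapeMap (d := d) n) ↑((saws d n).filter fun ω => ω ∉ escapeResidual d n) := by
  intro ω₁ h₁ ω₂ h₂ heq
  obtain ⟨hs₁, hR₁⟩ := Finset.mem_filter.1 (Finset.mem_coe.1 h₁)
  obtain ⟨hs₂, hR₂⟩ := Finset.mem_filter.1 (Finset.mem_coe.1 h₂)
  by_cases hf₁ : EndFree ω₁ n <;> by_cases hf₂ : EndFree ω₂ n
  · -- both prolonged: restrict
    have e : extendTo ω₁ n (Classical.choose hf₁ 0) = extendTo ω₂ n (Classical.choose hf₂ 0) := by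
      have := heq; unfold escapeMap at this; rwa [dif_pos hf₁, dif_pos hf₂] at this
    rw [← restrictTo_extendTo hs₁ (Classical.choose hf₁ 0), ← restrictTo_extendTo hs₂ (Classical.choose hf₂ 0), e]
  · exact absurd ((heq ▸ endFree_escapeMap hf₁ : EndFree (escapeMap n ω₂) (n + 1)))
      (not_endFree_escapeMap hs₂ hf₂)
  · exact absurd ((heq.symm ▸ endFree_escapeMap hf₂ : EndFree (escapeMap n ω₁) (n + 1)))
      (not_endFree_escapeMap hs₁ hf₁)
  · -- both prepended
    have hn₁ : (freeNbrs (revWalk n ω₁) n).Nonempty := by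
      by_contra hc
      exact hR₁ (mem_escapeResidual.2 ⟨hs₁, hf₁, by
        rw [extCount, Finset.card_eq_zero]; exact Finset.not_nonempty_iff_eq_empty.1 hc⟩)
    have hn₂ : (freeNbrs (revWalk n ω₂) n).Nonempty := by
      by_contra hc
      exact hR₂ (mem_escapeResidual.2 ⟨hs₂, hf₂, by
        rw [extCount, Finset.card_eq_zero]; exact Finset.not_nonempty_iff_eq_empty.1 hc⟩)
    have e : prependVia n ω₁ (Classical.choose hn₁) = prependVia n ω₂ (Classical.choose hn₂) := by
      have := heq; unfold escapeMap at this; rwa [dif_neg hf₁, dif_neg hf₂, dif_pos hn₁, dif_pos hn₂] at this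
    exact prependVia_injOn hs₁ hs₂ (Classical.choose_spec hn₁) (Classical.choose_spec hn₂) e

/-! ### `cₙ ≤ cₙ₊₁ + #R` -/

open Classical in
/-- **The escape reduction: `cₙ ≤ cₙ₊₁ + #R`.** The number of `n`-step self-avoiding walks exceeds the
number of `(n+1)`-step ones by at most the number of `n`-step walks with a doomed end and a completely
surrounded start. [cite: BDGS2012, §1.3] -/
theorem count_le_count_succ_add_card_escapeResidual (d n : ℕ) :
    count d n ≤ count d (n + 1) + (escapeResidual d n).card := by
  classical
  have hsplit : (saws d n).card =
      ((saws d n).filter fun ω => ω ∉ escapeResidual d n).card +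
        ((saws d n).filter fun ω => ¬ (ω ∉ escapeResidual d n)).card :=
    (Finset.card_filter_add_card_filter_not _).symm
  have hR : ((saws d n).filter fun ω => ¬ (ω ∉ escapeResidual d n)) = escapeResidual d n := by
    ext ω
    simp only [Finset.mem_filter, not_not]
    exact ⟨fun h => h.2, fun h => ⟨(mem_escapeResidual.1 h).1, h⟩⟩
  have hinj := Finset.card_le_card_of_injOn (escapeMap (d := d) n)
    (fun ω hω => escapeMap_mem_saws (Finset.mem_filter.1 hω).1 (Finset.mem_filter.1 hω).2)
    (escapeMap_injOn d n)
  rw [← card_saws, ← card_saws, hsplit, hR]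
  omega

/-- **O'Brien's inequality wherever the escape residual is empty.** [cite: BDGS2012, §1.3] -/
theorem count_le_count_succ_of_escapeResidual_eq_empty {n : ℕ} (h : escapeResidual d n = ∅) :
    count d n ≤ count d (n + 1) := by
  have := count_le_count_succ_add_card_escapeResidual d n
  rw [h, Finset.card_empty, add_zero] at this
  exact this

/-- The escape reduction is at least as strong as the trapped-at-both-ends bound and complements the
reversal route: `cₙ ≤ cₙ₊₁ + min (#T₂, #R)`. [cite: BDGS2012, §1.3] -/
theorem count_le_count_succ_add_min_card (d n : ℕ) :
    count d n ≤ count d (n + 1) + min (doublyTrapped d n).card (escapeResidual d n).card := by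
  rcases le_total (doublyTrapped d n).card (escapeResidual d n).card with h | h
  · rw [min_eq_left h]; exact count_le_count_succ_add_card_doublyTrapped d n
  · rw [min_eq_right h]; exact count_le_count_succ_add_card_escapeResidual d n

end Literature.Probability.RandomPlanarGeometry.SAW.Zd
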